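import Summits.HodgeConjecture.HodgeConjecture.Theorems.NoetherLefschetzOneUpSummitGrantedFourfoldsCohomologicallyAlgebraicProducts
import Summits.HodgeConjecture.HodgeConjecture.Theorems.CurveNetMordellWeilCubicFourfoldNormalFormHolds
import Literature.AlgebraicGeometry.HodgeTheory.CMTimesNonCMEllipticProductsHodgeClasses
import Literature.AlgebraicGeometry.HodgeTheory.AlgebraicClassesHodgeTypeHolds
import Literature.AlgebraicGeometry.HodgeTheory.NonCMEllipticCurvePowersHodgeClasses
import Literature.AlgebraicGeometry.HodgeTheory.AbelJacobiPullbackHodgeSection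
import Literature.AlgebraicGeometry.HodgeTheory.HodgeTypeExteriorProduct
import Literature.AlgebraicGeometry.HodgeTheory.CubicFourfoldHodgeConjectureAllDegrees

/-!
# The Hodge conjecture transfers along a cohomologically algebraic factor:
# `HC(Y) ⟹ HC(Y × V)` for `V` with all cohomology algebraic (helper for crux `SummitGrantedFourfolds`,
# stmt-HodgeConjecture-14600)

Route `HodgeConjecture/NoetherLefschetzOneUp`, crux `SummitGrantedFourfolds` (stmt-HodgeConjecture-14600:
the Hodge conjecture beyond dimension four granted the fourfold middle degree). Companion of
`…CohomologicallyAlgebraicProducts` (closure of "cohomologically algebraic" under `⊗`). Here the second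
factor only is assumed cohomologically algebraic (`Nᵏ H²ᵏ(V) = H²ᵏ(V)` for all `k`, `H^{odd}(V) = 0`:
surfaces with `p_g = q = 0`, curves `≅ ℙ¹`, projective spaces, their products), while the first factor
`Y` is ANY smooth projective variety satisfying the Hodge conjecture (cycle part, all codimensions):

* `hodgeClasses_algebraic_tensor_of_hodgeClasses_algebraic` — **every rational `(p,p)`-class on
  `Y × V` is algebraic**; `hodgeConjectureFor_tensor_of_left` — `HodgeConjectureFor (n + d) (Y ⊗ V)`.

PROOF (Voisin I, §11.3.3: "the Künneth components of a Hodge class are morphisms of Hodge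
structures", run on the tree's carriers). Choose rational bases `z_{j,s}` of the `Hʲ(V(ℂ); ℂ)`
(`exists_basis_isRationalClass`); by the bijective Künneth theorem (`kunnethSum_bijective`) a class
`c ∈ H^{2p}((Y ⊗ V)(ℂ))` is uniquely `Σ pr_Y^* y_{j,s} ∪ pr_V^* z_{j,s}`.
(1) RATIONALITY of the coefficients: the cross products of rational bases form a rational spanning
family, a rational `c` is a `ℚ`-combination of it (`exists_rat_combination_of_isRationalClass`),
regrouping gives a Künneth expansion with rational coefficients, and uniqueness identifies it.
(2) HODGE TYPE of the coefficients: every class of `H²ⁱ(V)` is algebraic, hence of type `(i,i)`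
(`isOfHodgeType_of_mem_algebraicClasses_of_isSmoothProjective`); the Hodge GRADING `h = Σ (P−Q) π_{(P,Q)}`
(`HodgeModel.grading`) of `Y ⊗ V` therefore satisfies `h(pr_Y^* y ∪ pr_V^* z_{2i,s}) = pr_Y^*(h y) ∪ pr_V^* z_{2i,s}`
(types add under exterior products: `cupPreservesHodgeType_of_multiplicative_deRham` with the PROVED
multiplicative de Rham theorem `exists_deRhamIsoFamily_holds`, pull-backs preserve types
`IsOfHodgeType.map_of_isSmoothProjective`, type pieces `HodgeModel.typePiece` with
`hodgePQ_independent_of_hodgeModel_holds`); `c` of type `(p,p)` has `h c = 0`, so by uniqueness every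
`h y_{2i,s} = 0`, i.e. `y_{2i,s}` is of type `(p−i, p−i)` (`HodgeModel.isOfHodgeType_of_grading_eq_zero`).
(3) By `HC(Y)` the `y_{2i,s}` are algebraic, the `z_{2i,s}` are algebraic, and EXTERIOR PRODUCTS of
algebraic classes are algebraic (`cupProduct_map_fst_map_snd_mem_supportedClasses`, Voisin II proof of
Prop. 9.20); odd `j` contribute nothing. Hence `c ∈ Nᵖ`.

Corollaries (unconditional): `HC(Y × V)` for `dim Y ≤ 3` (`hodgeClasses_algebraic_of_dim_le_three_holds`)
and `V` cohomologically algebraic — e.g. `(threefold) × Enriques × ⋯ × Enriques × ℙᴺ`; for `Y` a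
smooth CUBIC FOURFOLD (`hodgeTwoTwo_algebraic_cubicFourfold_holds`, Zucker) times such `V`; and for
`Y = S₁ × S₂` with one `p_g = 0` factor (sibling file `…K3TypeNetsPgZeroFactor`) times such `V` — e.g.
the sixfold `K3 × Enriques × Enriques`.

No definition, no named-fact hypothesis, no `sorry`.

References: Voisin, *Hodge Theory and Complex Algebraic Geometry I*, §7.1.1, §11.3.2 Thm. 11.38, §11.3.3
Lemma 11.41, Prop. 11.20; Voisin II, Prop. 9.20 (proof, first display); Hatcher, *Algebraic Topology*,
Thm. 3.16.
-/

-- `Summit.HodgeConjecture.HodgeConjecture.Theorems` is the mandated namespace (single-conjunct summit),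
-- which `linter.dupNamespace` flags; the lakefile turns the linter off tree-wide, restated here so
-- stand-alone elaboration is warning-free too.
set_option linter.dupNamespace false

noncomputable section

open CategoryTheory AlgebraicGeometry MonoidalCategory CartesianMonoidalCategory
open Literature.AlgebraicGeometry Literature.AlgebraicGeometry.Motives
open Literature.AlgebraicGeometry.HodgeTheory Literature.AlgebraicTopology.SingularHomology

namespace Summit.HodgeConjecture.HodgeConjecture.Theorems

namespace CohomologicallyAlgebraic

/-! ### Small bookkeeping -/

/-- A finite rational combination of rational classes is rational. [cite: HatcherAT2002, §3.1] -/
theorem isRationalClass_sum_ratCast_smul {T : Type} [TopologicalSpace T] {k : ℕ} {S : Type*}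
    (s : Finset S) (q : S → ℚ) {v : S → singularCohomology ℂ ℂ T k} (hv : ∀ i, IsRationalClass (v i)) :
    IsRationalClass (∑ i ∈ s, ((q i : ℚ) : ℂ) • v i) := by
  classical
  induction s using Finset.induction_on with
  | empty => rw [Finset.sum_empty]; exact IsRationalClass.zero
  | insert x s hx ih => rw [Finset.sum_insert hx]; exact ((hv x).smul (q x)).add ih

/-! ### The Hodge grading across an exterior product with a factor of pure type -/

/-- **Derivation identity of the Hodge grading across an exterior product whose second factor has
pure type `(i, i)`**: for Hodge models `M` of `Y ⊗ V` and `MY` of `Y`, `a ∈ Hᵏ(Y(ℂ))` arbitrary and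
`b ∈ Hʲ(V(ℂ))` of type `(i, i)`,
`h_M (pr_Y^* a ∪ pr_V^* b) = pr_Y^* (h_{MY} a) ∪ pr_V^* b` — decompose `a` into its types `(P, Q)`
(`HodgeModel.sum_typeProj`); the exterior product of the `(P,Q)`-piece with `b` has type `(P+i, Q+i)`
(types add: `cupPreservesHodgeType_of_multiplicative_deRham` + `IsOfHodgeType.map_of_isSmoothProjective`),
on which `h_M` is `(P+i) − (Q+i) = P − Q`. [cite: VoisinHodgeI2002, §7.1.1 and §11.3.2 Thm. 11.38] -/
theorem grading_cupProduct_fst_snd {n d : ℕ} {Y V : SchemeOver ℂ} (hY : IsSmoothProjective n Y)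
    (hV : IsSmoothProjective d V) (M : HodgeModel (n + d) (Y ⊗ V)) (MY : HodgeModel n Y)
    {k j s : ℕ} (h : k + j = s) {i : ℕ} (hj : j = 2 * i) (a : complexBetti Y k) {b : complexBetti V j}
    (hb : IsOfHodgeType d V j i i b) :
    M.grading s (cupProduct h (complexBetti.map (fst Y V) k a) (complexBetti.map (snd Y V) j b)) =
      cupProduct h (complexBetti.map (fst Y V) k (MY.grading k a)) (complexBetti.map (snd Y V) j b) := by
  classical
  have hX : IsSmoothProjective (n + d) (Y ⊗ V) := IsSmoothProjective.tensor_holds hY hV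
  have hcup : CupPreservesHodgeType (n + d) (Y ⊗ V) :=
    cupPreservesHodgeType_of_multiplicative_deRham
      (fun E _ _ _ ↦ Literature.NumberTheory.Transcendental.exists_deRhamIsoFamily_holds E) hX
  -- the bilinear expression, linear in `a`
  set F : complexBetti Y k →ₗ[ℂ] complexBetti (Y ⊗ V) s :=
    (cupProduct h).flip (complexBetti.map (snd Y V) j b) ∘ₗ (complexBetti.map (fst Y V) k).hom with hF
  have hFa : ∀ x : complexBetti Y k, F x =
      cupProduct h (complexBetti.map (fst Y V) k x) (complexBetti.map (snd Y V) j b) := fun _ ↦ rfl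
  -- on a piece of type `(P, Q)` the grading of the product acts by `P - Q`
  have hpiece : ∀ (pq : ↥(Finset.HasAntidiagonal.antidiagonal k)) (x : complexBetti Y k),
      x ∈ MY.typePiece k pq → M.grading s (F x) = (((pq.1.1 : ℕ) : ℂ) - pq.1.2) • F x := by
    intro pq x hx
    have hPQ := Finset.HasAntidiagonal.mem_antidiagonal.1 pq.2
    have hmem : (pq.1.1 + i, pq.1.2 + i) ∈ Finset.HasAntidiagonal.antidiagonal s :=
      Finset.HasAntidiagonal.mem_antidiagonal.2 (by simp only; omega)
    have htype : IsOfHodgeType (n + d) (Y ⊗ V) s (pq.1.1 + i) (pq.1.2 + i) (F x) := by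
      rw [hFa]
      exact hcup h ((MY.isOfHodgeType_of_mem_typePiece hx).map_of_isSmoothProjective hX hY (fst Y V))
        (hb.map_of_isSmoothProjective hX hV (snd Y V))
    have hin : F x ∈ M.typePiece s ⟨(pq.1.1 + i, pq.1.2 + i), hmem⟩ :=
      M.mem_typePiece_of_isOfHodgeType hodgePQ_independent_of_hodgeModel_holds hX hmem htype
    rw [M.grading_apply_of_mem hin]
    congr 1
    push_cast
    ring
  -- decompose `a` into types and conclude by linearity
  calc M.grading s (F a)
      = M.grading s (F (∑ pq, MY.typeProj k pq a)) := by rw [MY.sum_typeProj]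
    _ = ∑ pq, M.grading s (F (MY.typeProj k pq a)) := by rw [map_sum, map_sum]
    _ = ∑ pq, (((pq.1.1 : ℕ) : ℂ) - pq.1.2) • F (MY.typeProj k pq a) :=
        Finset.sum_congr rfl fun pq _ ↦ hpiece pq _ (MY.typeProj_mem k pq a)
    _ = F (∑ pq, (((pq.1.1 : ℕ) : ℂ) - pq.1.2) • MY.typeProj k pq a) := by
        rw [map_sum]
        exact Finset.sum_congr rfl fun pq _ ↦ by rw [map_smul]
    _ = F (MY.grading k a) := by
        rw [HodgeModel.grading, LinearMap.sum_apply]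
        rfl

/-! ### The transfer theorem -/

/-- **The Hodge conjecture transfers along a cohomologically algebraic factor.** Let `Y` (dim `n`) and
`V` (dim `d`) be smooth projective complex varieties; assume every even-degree class of `V` is algebraic
and the odd cohomology of `V` vanishes, and assume the cycle part of the Hodge conjecture for `Y` in
every codimension. Then every rational `(p,p)`-class on `Y ⊗ V` is algebraic. Proof in the module
docstring (Künneth coefficients along rational algebraic bases of `H*(V)` are rational — rational
spanning family + uniqueness — and of type `(p−i, p−i)` — the grading kills `c`, commutes past the
pure-type factor, uniqueness —, hence algebraic by `HC(Y)`; exterior products of algebraic classes are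
algebraic). [cite: VoisinHodgeI2002, §11.3.3 Lemma 11.41 and §11.3.2 Thm. 11.38]
[cite: VoisinHodgeII2003, proof of Prop. 9.20 (first display)] [cite: HatcherAT2002, §3.2 Thm. 3.16] -/
theorem hodgeClasses_algebraic_tensor_of_hodgeClasses_algebraic {n d : ℕ} {Y V : SchemeOver ℂ}
    (hY : IsSmoothProjective n Y) (hV : IsSmoothProjective d V)
    (hVev : ∀ k : ℕ, algebraicClasses V k = ⊤)
    (hVodd : ∀ k : ℕ, Subsingleton (complexBetti V (2 * k + 1)))
    (hHC : ∀ (p : ℕ) (c : complexBetti Y (2 * p)), IsRationalClass c → IsOfHodgeType n Y (2 * p) p p c →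
      c ∈ algebraicClasses Y p)
    (p : ℕ) (c : complexBetti (Y ⊗ V) (2 * p)) (hc : IsRationalClass c)
    (hpp : IsOfHodgeType (n + d) (Y ⊗ V) (2 * p) p p c) : c ∈ algebraicClasses (Y ⊗ V) p := by
  classical
  have hX : IsSmoothProjective (n + d) (Y ⊗ V) := IsSmoothProjective.tensor_holds hY hV
  -- transport lemmas across the two spellings `m = 2 * l` of an even degree
  have hVtype : ∀ (j i : ℕ), j = 2 * i → ∀ b : complexBetti V j,
      b ∈ supportedClasses V j i ∧ IsOfHodgeType d V j i i b := by
    rintro j i rfl b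
    have hb : b ∈ algebraicClasses V i := by rw [hVev i]; exact Submodule.mem_top
    exact ⟨hb, isOfHodgeType_of_mem_algebraicClasses_of_isSmoothProjective hV i hb⟩
  have hVzero : ∀ (j i : ℕ), j = 2 * i + 1 → ∀ b : complexBetti V j, b = 0 := by
    rintro j i rfl b
    haveI := hVodd i
    exact Subsingleton.elim b 0
  -- rational bases of the `Hʲ(V(ℂ); ℂ)`, `j ≤ 2d`
  choose r z hz using fun j : Fin (2 * d + 1) ↦ exists_basis_isRationalClass hV (j : ℕ)
  -- Hodge models
  obtain ⟨M⟩ := nonempty_hodgeModel_holds hX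
  obtain ⟨MY⟩ := nonempty_hodgeModel_holds hY
  -- (1) a Künneth expansion with RATIONAL coefficients
  -- rational bases of the `H^{2p - j}(Y(ℂ); ℂ)`
  choose rY w hw using fun jt : LerayHirsch.Idx (kDeg fun j ↦ Fin (r j)) (2 * p) ↦
    exists_basis_isRationalClass hY (2 * p - (jt.1.1 : ℕ))
  -- the rational spanning family of cross products
  let F : (Σ jt : LerayHirsch.Idx (kDeg fun j ↦ Fin (r j)) (2 * p), Fin (rY jt)) →
      complexBetti (Y ⊗ V) (2 * p) := fun x ↦
    cupProduct (Nat.sub_add_cancel x.1.2) (complexBetti.map (fst Y V) _ (w x.1 x.2))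
      (complexBetti.map (snd Y V) _ (z x.1.1.1 x.1.1.2))
  have hFrat : ∀ x, IsRationalClass (F x) := fun x ↦
    IsRationalClass.cup _ ((hw x.1 x.2).map _) ((hz x.1.1.1 x.1.1.2).map _)
  have hFspan : Submodule.span ℂ (Set.range F) = ⊤ := by
    rw [eq_top_iff]
    rintro x -
    obtain ⟨y₀, rfl⟩ := (kunnethSum_bijective z p hY hV).2 x
    unfold kunnethSum
    refine Submodule.sum_mem _ fun jt _ ↦ ?_
    obtain ⟨α, hα⟩ := (Submodule.mem_span_range_iff_exists_fun ℂ).1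
      (show y₀ jt ∈ Submodule.span ℂ (Set.range (w jt)) by rw [(w jt).span_eq]; exact Submodule.mem_top)
    rw [← hα, map_sum, LinearMap.map_sum₂]
    refine Submodule.sum_mem _ fun t _ ↦ ?_
    rw [map_smul, LinearMap.map_smul₂]
    exact Submodule.smul_mem _ _ (Submodule.subset_span ⟨⟨jt, t⟩, rfl⟩)
  obtain ⟨q, hq⟩ := exists_rat_combination_of_isRationalClass hFrat hFspan hc
  -- the rational coefficient family
  let y : LerayHirsch.Src ℂ (kDeg fun j ↦ Fin (r j)) (ComplexPoints Y) (2 * p) :=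
    fun jt ↦ ∑ t, ((q ⟨jt, t⟩ : ℚ) : ℂ) • w jt t
  have hyrat : ∀ jt, IsRationalClass (y jt) := fun jt ↦
    isRationalClass_sum_ratCast_smul _ _ (hw jt)
  have hyc : kunnethSum z p y = c := by
    rw [hq, kunnethSum, Fintype.sum_sigma]
    refine Finset.sum_congr rfl fun jt _ ↦ ?_
    change cupProduct _ (complexBetti.map (fst Y V) _ (∑ t, ((q ⟨jt, t⟩ : ℚ) : ℂ) • w jt t)) _ = _
    rw [map_sum, LinearMap.map_sum₂]
    refine Finset.sum_congr rfl fun t _ ↦ ?_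
    rw [map_smul, LinearMap.map_smul₂]
  -- (2) the grading of `Y` kills every coefficient
  have hgc : M.grading (2 * p) c = 0 := by
    have hmem : (p, p) ∈ Finset.HasAntidiagonal.antidiagonal (2 * p) :=
      Finset.HasAntidiagonal.mem_antidiagonal.2 (by omega)
    rw [M.grading_apply_of_mem (M.mem_typePiece_of_isOfHodgeType hodgePQ_independent_of_hodgeModel_holds
      hX hmem hpp)]
    simp
  have hgrad : kunnethSum z p (fun jt ↦ MY.grading _ (y jt)) =
      kunnethSum z p (0 : LerayHirsch.Src ℂ (kDeg fun j ↦ Fin (r j)) (ComplexPoints Y) (2 * p)) := by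
    have h0 : kunnethSum z p
        (0 : LerayHirsch.Src ℂ (kDeg fun j ↦ Fin (r j)) (ComplexPoints Y) (2 * p)) = 0 := by
      unfold kunnethSum
      exact Finset.sum_eq_zero fun jt _ ↦ by
        rw [Pi.zero_apply, map_zero, LinearMap.map_zero₂]
    rw [h0, ← hgc, ← hyc, kunnethSum, kunnethSum, map_sum]
    refine Finset.sum_congr rfl fun jt _ ↦ ?_
    obtain ⟨i, hi | hi⟩ := Nat.even_or_odd' (jt.1.1 : ℕ)
    · exact (grading_cupProduct_fst_snd hY hV M MY (Nat.sub_add_cancel jt.2) hi (y jt)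
        (hVtype _ i hi _).2).symm
    · rw [hVzero _ i hi (z jt.1.1 jt.1.2), map_zero, map_zero, map_zero, map_zero]
  have hy0 : ∀ jt, MY.grading _ (y jt) = 0 := fun jt ↦
    congrFun ((kunnethSum_bijective z p hY hV).1 hgrad) jt
  -- (3) every summand is an exterior product of algebraic classes
  have hterm : ∀ jt : LerayHirsch.Idx (kDeg fun j ↦ Fin (r j)) (2 * p),
      cupProduct (Nat.sub_add_cancel jt.2) (complexBetti.map (fst Y V) (2 * p - (jt.1.1 : ℕ)) (y jt))
        (complexBetti.map (snd Y V) (jt.1.1 : ℕ) (z jt.1.1 jt.1.2)) ∈ algebraicClasses (Y ⊗ V) p := by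
    intro jt
    have hjle : (jt.1.1 : ℕ) ≤ 2 * p := jt.2
    obtain ⟨i, hi | hi⟩ := Nat.even_or_odd' (jt.1.1 : ℕ)
    · -- even `j = 2i`: `y` of type `(p - i, p - i)` and rational, hence algebraic; `z` algebraic
      have hyN : y jt ∈ supportedClasses Y (2 * p - (jt.1.1 : ℕ)) (p - i) := by
        have key : ∀ (m l : ℕ), m = 2 * l → ∀ x : complexBetti Y m, IsRationalClass x →
            MY.grading m x = 0 → x ∈ supportedClasses Y m l := by
          rintro m l rfl x hx h0
          exact hHC l x hx (MY.isOfHodgeType_of_grading_eq_zero h0)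
        exact key _ (p - i) (by change 2 * p - (jt.1.1 : ℕ) = 2 * (p - i); omega) (y jt) (hyrat jt)
          (hy0 jt)
      have hzN : z jt.1.1 jt.1.2 ∈ supportedClasses V (jt.1.1 : ℕ) i := (hVtype _ i hi _).1
      have h := cupProduct_map_fst_map_snd_mem_supportedClasses hY hV (Nat.sub_add_cancel jt.2) hyN hzN
      rwa [Nat.sub_add_cancel (by omega : i ≤ p)] at h
    · -- odd `j`: the summand vanishes
      rw [hVzero _ i hi (z jt.1.1 jt.1.2), map_zero, map_zero]
      exact Submodule.zero_mem _
  rw [← hyc]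
  exact Submodule.sum_mem _ fun jt _ ↦ hterm jt

/-- **`HC(Y) ⟹ HC(Y × V)` for `V` cohomologically algebraic**, in the summit's spelling: from
`HodgeConjectureFor n Y` and a cohomologically algebraic smooth projective `V` of dimension `d`,
`HodgeConjectureFor (n + d) (Y ⊗ V)`. [cite: VoisinHodgeI2002, §11.3.3 Lemma 11.41]
[cite: VoisinHodgeII2003, proof of Prop. 9.20 (first display)] -/
theorem hodgeConjectureFor_tensor_of_left {n d : ℕ} {Y V : SchemeOver ℂ}
    (hY : IsSmoothProjective n Y) (hV : IsSmoothProjective d V)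
    (hVev : ∀ k : ℕ, algebraicClasses V k = ⊤)
    (hVodd : ∀ k : ℕ, Subsingleton (complexBetti V (2 * k + 1)))
    (hHC : HodgeConjectureFor n Y) : HodgeConjectureFor (n + d) (Y ⊗ V) :=
  ⟨nonempty_hodgeModel_holds (IsSmoothProjective.tensor_holds hY hV),
    hodgeClasses_algebraic_tensor_of_hodgeClasses_algebraic hY hV hVev hVodd hHC.2⟩

/-! ### Unconditional corollaries -/

/-- **`HC(Y × V)` for `dim Y ≤ 3` and `V` cohomologically algebraic** (the Hodge conjecture holds in
dimension `≤ 3`: `hodgeClasses_algebraic_of_dim_le_three_holds`). E.g. `(any threefold) × Enriques`,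
recovering `…ProductsPgqZeroSurface` by a second route, and `(any threefold) × Enriques × ℙᴺ`.
[cite: VoisinHodgeII2003, §10.2.3 proof of Prop. 10.26] [cite: VoisinHodgeI2002, §11.3.3 Lemma 11.41] -/
theorem hodgeConjectureFor_tensor_of_dim_le_three {n d : ℕ} {Y V : SchemeOver ℂ} (hn : n ≤ 3)
    (hY : IsSmoothProjective n Y) (hV : IsSmoothProjective d V)
    (hVev : ∀ k : ℕ, algebraicClasses V k = ⊤)
    (hVodd : ∀ k : ℕ, Subsingleton (complexBetti V (2 * k + 1))) :
    HodgeConjectureFor (n + d) (Y ⊗ V) :=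
  hodgeConjectureFor_tensor_of_left hY hV hVev hVodd
    (hodgeConjectureFor_of_dim_le_three hodgeClasses_algebraic_of_dim_le_three_holds
      nonempty_hodgeModel_holds hn hY)

/-- **`HC(Y × S)` for `dim Y ≤ 3` and `S` a surface with `p_g = 0`, `b₁ = 0`** — in particular
`(abelian threefold) × Enriques`, `(Calabi–Yau threefold) × Godeaux` — as a fivefold, by the transfer
theorem. [cite: VoisinHodgeI2002, Thm. 11.30 and §11.3.3] -/
theorem hodgeConjectureFor_tensor_surface_of_dim_le_three {n : ℕ} {Y S : SchemeOver ℂ} (hn : n ≤ 3)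
    (hY : IsSmoothProjective n Y) (hS : IsSmoothProjective 2 S)
    (hpg : ∃ A : HodgeModel 2 S, Module.finrank ℂ ↥(A.hodgePQ 2 2 0) = 0)
    (hq : Subsingleton (complexBetti S 1)) : HodgeConjectureFor (n + 2) (Y ⊗ S) :=
  hodgeConjectureFor_tensor_of_dim_le_three hn hY hS (algebraicClasses_eq_top_of_pg_zero hS hpg)
    (subsingleton_complexBetti_odd_of_b₁ hS hq)

/-- **`HC(X × V)` for `X` a smooth cubic fourfold and `V` cohomologically algebraic** (the Hodge
conjecture for cubic fourfolds: Zucker 1977 / Murre 1977 / Conte–Murre, the tree's discharged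
`hodgeTwoTwo_algebraic_cubicFourfold_holds`) — e.g. the sixfold `(cubic fourfold) × Enriques`.
[cite: Zucker1977, (3.2) Theorem] [cite: VoisinHodgeI2002, §11.3.3 Lemma 11.41] -/
theorem hodgeConjectureFor_cubicFourfold_tensor {d : ℕ} {X V : SchemeOver ℂ}
    (hX : IsSmoothHypersurface 4 3 X) (hV : IsSmoothProjective d V)
    (hVev : ∀ k : ℕ, algebraicClasses V k = ⊤)
    (hVodd : ∀ k : ℕ, Subsingleton (complexBetti V (2 * k + 1))) :
    HodgeConjectureFor (4 + d) (X ⊗ V) :=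
  hodgeConjectureFor_tensor_of_left hX.1 hV hVev hVodd
    (hodgeConjectureFor_cubicFourfold_of hodgeTwoTwo_algebraic_cubicFourfold_holds
      lefschetzOneOne_rational_holds (nonempty_hardLefschetzNFold_holds 4 X) nonempty_hodgeModel_holds hX)

/-- **`HC((S₁ × S₂) × S₃)` for `p_g(S₁) = 0 ∨ p_g(S₂) = 0` and `S₃` with `p_g = 0`, `b₁ = 0`** — e.g.
the sixfold `K3 × Enriques × Enriques` (the K3 factor is NOT cohomologically algebraic; the fourfold
`K3 × Enriques` satisfies the Hodge conjecture by the sibling file `…K3TypeNetsPgZeroFactor`, and the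
transfer theorem adds the last factor). [cite: VoisinHodgeI2002, Thm. 11.30 and §11.3.3] -/
theorem hodgeConjectureFor_surfaces₃_of_pg_zero {S₁ S₂ S₃ : SchemeOver ℂ}
    (h₁ : IsSmoothProjective 2 S₁) (h₂ : IsSmoothProjective 2 S₂) (h₃ : IsSmoothProjective 2 S₃)
    (hpg : (∃ A : HodgeModel 2 S₁, Module.finrank ℂ ↥(A.hodgePQ 2 2 0) = 0) ∨
      ∃ A : HodgeModel 2 S₂, Module.finrank ℂ ↥(A.hodgePQ 2 2 0) = 0)
    (hpg₃ : ∃ A : HodgeModel 2 S₃, Module.finrank ℂ ↥(A.hodgePQ 2 2 0) = 0)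
    (hq₃ : Subsingleton (complexBetti S₃ 1)) : HodgeConjectureFor (4 + 2) ((S₁ ⊗ S₂) ⊗ S₃) := by
  have h12 : HodgeConjectureFor 4 (S₁ ⊗ S₂) := by
    rcases hpg with hpg₁ | hpg₂
    · exact PgOneProductClasses.hodgeConjectureFor_prod_of_pg_zero_left h₁ h₂ hpg₁
    · exact PgOneProductClasses.hodgeConjectureFor_prod_of_pg_zero_right h₁ h₂ hpg₂
  exact hodgeConjectureFor_tensor_of_left (IsSmoothProjective.tensor_holds h₁ h₂) h₃
    (algebraicClasses_eq_top_of_pg_zero h₃ hpg₃) (subsingleton_complexBetti_odd_of_b₁ h₃ hq₃) h12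

end CohomologicallyAlgebraic

end Summit.HodgeConjecture.HodgeConjecture.Theorems

end
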